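import Literature.Algebra.Homology.DiscreteRepOpenSubgroup
import Literature.Algebra.Homology.ExtAdjunctionCanonical
import HarnessLib

/-!
# Shapiro's lemma in `C_Γ`, canonical form (compatible with Yoneda composition)

Topic `Algebra/Homology`; namespace `Literature.Algebra.Homology.DiscreteRep`.  Sequel of
`DiscreteRepOpenSubgroup` (`resD ⊣ coindD` for an open subgroup `U` of finite index, Shapiro via the
recursive isomorphisms of `ExtAdjunction`) and `ExtAdjunctionCanonical` (the canonical map
`x ↦ [η] ∘ R(x)` is bijective and compatible with composition); no named fact, no `sorry`.

* **`shapiroCanonical U hU A N n : Extⁿ_{C_U}(Res A, N) ≃+ Extⁿ_{C_Γ}(A, Coind N)`**,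
  `x ↦ [η_A] ∘ Coind(x)`, and **`shapiroCanonical_comp`**: it carries `x ∘ z` to
  `shapiroCanonical x ∘ Coind(z)` — the form needed for the compatibility of Shapiro's isomorphism
  with the duality pairings (Harari, Prop. 16.18).
* `shapiroCanonicalTriv : Extⁿ_{C_U}(k, N) ≃+ Extⁿ_{C_Γ}(k, Coind N)` (`Res k = k`).

## References
* D. Harari, *Galois Cohomology and Class Field Theory* (2020), Remark 16.13, Prop. 16.18. [Harari2020]
* C. A. Weibel, *An introduction to homological algebra* (1994), Lemma 6.3.2. [Weibel1994]
-/

-- CITATION-FIX (2026-08-27, door-c4 g13; referee flag Q-g51-1, held copy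
-- `book:harari2017-galois-cohomology-class-field-theory`): earlier revisions cited "Harari Prop. 16.17"
-- for Shapiro-type isomorphisms of `Ext`.  Prop. 16.17 (p. 272) is the compatibility of the cup-product
-- with the `Ext` pairing; the printed homes are Remark 16.13 (p. 269: `Ext_G^i(A, I_G^H(B)) ≃
-- Ext_H^i(A, B)`) and Proposition 1.39 (p. 48, first variable; for `H` open by §4.3 (4), p. 97);
-- Prop. 16.18 (p. 272) is the compatibility of the pairings with these isomorphisms and with the
-- corestriction.  Citations corrected; declarations unchanged.

noncomputable section

universe u

namespace Literature.Algebra.Homology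

namespace DiscreteRep

open CategoryTheory CategoryTheory.Limits CategoryTheory.Abelian

variable {k Γ : Type u} [CommRing k] [Group Γ] [TopologicalSpace Γ] [IsTopologicalGroup Γ]
  (U : Subgroup Γ) (hU : IsOpen (U : Set Γ)) [U.FiniteIndex]

/-- **Shapiro's lemma, canonical form: `Extⁿ_{C_U}(Res A, N) ≃+ Extⁿ_{C_Γ}(A, Coind N)`,
`x ↦ [η_A] ∘ Coind(x)`.** [cite: Harari2020, Remark 16.13][cite: Weibel1994, Lemma 6.3.2] -/
def shapiroCanonical (A : DiscreteRepCat k Γ) (N : DiscreteRepCat k U) (n : ℕ) :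
    Ext ((resD k U).obj A) N n ≃+ Ext A ((coindD k U hU).obj N) n :=
  ExtAdjunction.extAdjunctionAddEquiv (resCoindAdj U hU) A N n

/-- Formula. [cite: Harari2020, Remark 16.13] -/
theorem shapiroCanonical_apply (A : DiscreteRepCat k Γ) (N : DiscreteRepCat k U) (n : ℕ)
    (x : Ext ((resD k U).obj A) N n) :
    shapiroCanonical U hU A N n x =
      (Ext.mk₀ (ExtAdjunction.unitHom (resCoindAdj U hU) A)).comp
        (x.mapExactFunctor (coindD k U hU)) (zero_add n) := rfl

/-- **Compatibility with Yoneda composition**: `Sh(x ∘ z) = Sh(x) ∘ Coind(z)`.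
[cite: Harari2020, Proposition 16.18] -/
theorem shapiroCanonical_comp (A : DiscreteRepCat k Γ) {N N' : DiscreteRepCat k U} {a b c : ℕ}
    (x : Ext ((resD k U).obj A) N a) (z : Ext N N' b) (h : a + b = c) :
    shapiroCanonical U hU A N' c (x.comp z h) =
      (shapiroCanonical U hU A N a x).comp (z.mapExactFunctor (coindD k U hU)) h :=
  ExtAdjunction.extAdjunctionMap_comp (resCoindAdj U hU) A x z h

/-- In degree `0`: Frobenius reciprocity on `mk₀`. [cite: Harari2020, Remark 16.13] -/
theorem shapiroCanonical_mk₀ (A : DiscreteRepCat k Γ) (N : DiscreteRepCat k U)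
    (f : (resD k U).obj A ⟶ N) :
    shapiroCanonical U hU A N 0 (Ext.mk₀ f) = Ext.mk₀ ((resCoindAdj U hU).homEquiv A N f) :=
  ExtAdjunction.extAdjunctionMap_mk₀ (resCoindAdj U hU) A N f

/-- **`Hⁿ(U, N) ≃+ Hⁿ(Γ, Coind N)`** (`Hⁿ(G, ·) = Extⁿ_{C_G}(k, ·)`; `Res k = k` definitionally),
canonical form. [cite: Harari2020, Remark 16.13] -/
def shapiroCanonicalTriv (N : DiscreteRepCat k U) (n : ℕ) :
    Ext (triv (k := k) (Γ := U) k) N n ≃+ Ext (triv (k := k) (Γ := Γ) k) ((coindD k U hU).obj N) n :=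
  shapiroCanonical U hU (triv (k := k) (Γ := Γ) k) N n

end DiscreteRep

end Literature.Algebra.Homology
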